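import Summits.Ventures.Crystal3D.Theorems.StickyWulffConstantCoaxialWallLawTriadic
import Summits.Ventures.Crystal3D.Theorems.StickyWulffConstantCoaxialWallLawFrame
import Summits.Ventures.Crystal3D.Theorems.StickyWulffConstantGenericWallFloorTwinNormals
import Summits.Ventures.Crystal3D.Theorems.StickyWulffConstantGenericWallFloorStackLedgerLocalTools
import Summits.Ventures.Crystal3D.Theorems.StickyWulffConstantGenericWallFloorNonChainCriterion
import HarnessLib

/-!
# The TRIADIC module `A·Λ₀[1/3]` of a frame and its closure under `{111}` mirrors
# (crux `CoaxialWallLaw`, stmt-Ventures-19481, line `WallLedgerF`; also lane G's registry, stmt-Ventures-19480)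

HONEST FRAMING. Venture `Summits/Ventures/Crystal3D` (cell `crystal3d-full`), helper `--supports` the crux
`CoaxialWallLaw` of `route-Ventures-StickyWulffConstant` (REGISTERED line `WallLedgerF`, open stub
`stub_coaxialTwoSlabAdhesion`).  Algebra only; rung credit only; F-C1 not moved; NOT the stub.

PURPOSE.  Lane G's `…OffReach` / `…OffReachCountable` prove the wall floor (`c₀ = 1`, arbitrary fillings, modulo
`ExactOnly`(C12-55) and `StarPairFar`) for every relative translation OFF the countable REGISTRY SET
`A₁Λ₀ − A₂Λ₀ + reachGroup (chainFrames e₃ A₁ u₁) − reachGroup (chainFrames (−e₃) A₂ u₂)`.  The sequel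
`…CoaxialWallLawTriadicRegistry` makes «off a countable set» ARITHMETIC: the registry set lies in the TRIADIC MODULE
`A₁·Λ₀[1/3] + A₂·Λ₀[1/3]`, `Λ₀[1/3] = {v : 3^j v ∈ Λ₀ for some j}`.  This file is the algebra.  Throughout,
«`v` is TRIADIC over `A`» is spelled `∃ j : ℕ, 3^j • A⁻¹ v ∈ Λ₀` (no new definition):
* `inner_lattice_menu` — a menu normal `m` of a frame `G` (`⟪G w, m⟫ ∈ {0, ±√(2/3)}` on slots) has `⟪G x, m⟫ ∈ √(2/3)·ℤ`
  on ALL of `Λ₀` (the sharp, parity-respecting form: heights of lattice points are INTEGER layer spacings; via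
  `exists_zsum_slots_of_mem_fcc`); `exists_lattice_eq_sqrt6_menu` — `√6·m = G y` for some `y ∈ Λ₀`;
* closure of triadic vectors under `+`, `−`, integer multiples and THIRDS (`triadicVec_add/sub/neg/zsmul/third`);
* frames mapping `Λ₀` into `A·Λ₀[1/3]`: `triadicLattice_self`, `_of_image_eq` (equal linear lattices),
  **`triadicLattice_twin`** (a `{111}` mirror divides by at most `3`: `R_m(G x) = G x − (2a/3)·(√6 m)` with
  `⟪G x, m⟫ = a√(2/3)`), `_of_image_eq_twin`, **`triadicLattice_of_coaxial`** (every CO-AXIAL partner of `A₁` — equal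
  linear lattice or mirror twin, `eq_or_twin_of_coaxial` — maps `Λ₀` into `A₁·Λ₀[1/3]`);
* `inner_menu_of_triadicVec` — the HEIGHT of a triadic vector along any menu normal of `A` lies in `√(2/3)·ℤ[1/3]`;
  `not_triadicVec_of_inner` — so a vector of height `r·√(2/3)` with `3^j r ∉ ℤ` for all `j` (e.g. `r = a + ½`:
  `not_triadicVec_of_inner_half`; every irrational `r`) is NOT triadic.
ORIENTATION ANALOGUE (not used here): `…GenericWallFloorNonTriadicCriterion` (lane G) closes the frames with
triadic-rational cubic inner products `⟪A₁ cᵢ, G cⱼ⟫ ∈ ℤ[1/3]` under mirrors, for RELATIVE ORIENTATIONS; the present file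
is the TRANSLATION/lattice form (`A·Λ₀[1/3]`, parity kept: `½·√(2/3)` heights are excluded), which is what the registry
set needs.  `…CoaxialWallLawTriadic` has the same 3-adic idea for the word automaton (`triadic_reflect`).
WHAT THIS IS NOT: no packing statement; not the stub; F-C1 not moved.
-/

noncomputable section

namespace Summit.Ventures.Crystal3D.Theorems

open Summit.Ventures.Crystal3D Finset
open Literature.MathematicalPhysics.StatisticalMechanics (fccStacking barlowStacking barlowPos constHagg IsHaggSeq)
open scoped InnerProductSpace

/-! ### Lattice bookkeeping -/

/-- `0 ∈ Λ₀`. -/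
theorem zero_mem_fccLattice : (0 : EuclideanSpace ℝ (Fin 3)) ∈ fccStacking 1 (Real.sqrt (2 / 3)) := by
  simpa using fcc_zsmul_mem 0 (mem_fcc_of_mem_fccSlots (slotSite_mem 0))

/-- `Λ₀` is closed under multiplication by powers of three. -/
theorem pow_three_smul_mem_fcc (j : ℕ) {x : EuclideanSpace ℝ (Fin 3)} (hx : x ∈ fccStacking 1 (Real.sqrt (2 / 3))) :
    ((3 : ℝ) ^ j) • x ∈ fccStacking 1 (Real.sqrt (2 / 3)) := by
  have h := fcc_zsmul_mem (3 ^ j) hx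
  push_cast at h
  exact h

/-! ### Menu normals on the lattice -/

/-- **Menu normals take values in `√(2/3)·ℤ` on the whole lattice** (sharp form: a slot contributes `0` or `±1`). -/
theorem inner_lattice_menu (G : EuclideanSpace ℝ (Fin 3) ≃ₗᵢ[ℝ] EuclideanSpace ℝ (Fin 3)) {m : EuclideanSpace ℝ (Fin 3)}
    (hmenu : ∀ w ∈ fccSlots, ⟪G w, m⟫_ℝ = 0 ∨ ⟪G w, m⟫_ℝ = Real.sqrt (2 / 3) ∨ ⟪G w, m⟫_ℝ = -Real.sqrt (2 / 3))
    {x : EuclideanSpace ℝ (Fin 3)} (hx : x ∈ fccStacking 1 (Real.sqrt (2 / 3))) :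
    ∃ a : ℤ, ⟪G x, m⟫_ℝ = a * Real.sqrt (2 / 3) := by
  have val : ∀ w ∈ fccSlots, ∃ a : ℤ, ⟪G w, m⟫_ℝ = a * Real.sqrt (2 / 3) := by
    intro w hw
    rcases hmenu w hw with h | h | h
    · exact ⟨0, by rw [h]; simp⟩
    · exact ⟨1, by rw [h]; simp⟩
    · exact ⟨-1, by rw [h]; simp⟩
  obtain ⟨i, j, k, rfl⟩ := exists_zsum_slots_of_mem_fcc hx
  obtain ⟨a, ha⟩ := val _ (slotSite_mem 0)
  obtain ⟨b, hb⟩ := val _ (slotSite_mem 4)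
  obtain ⟨c, hc⟩ := val _ (slotSite_mem 8)
  refine ⟨i * a + j * b + k * c, ?_⟩
  simp only [map_add, map_smul, inner_add_left, inner_smul_left, ha, hb, hc, conj_trivial]
  push_cast
  ring

/-- Orthonormal expansion in a moved cubic frame: `v = Σ_l ⟪v, L c_l⟫ · L c_l`. -/
theorem eq_sum_cubicFrame (L : EuclideanSpace ℝ (Fin 3) ≃ₗᵢ[ℝ] EuclideanSpace ℝ (Fin 3)) (v : EuclideanSpace ℝ (Fin 3)) :
    v = ∑ l : Fin 3, ⟪v, L (cubicFrame l)⟫_ℝ • L (cubicFrame l) := by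
  apply ext_inner_right ℝ
  intro y
  rw [sum_inner, inner_eq_sum_frame L v y]
  refine Finset.sum_congr rfl fun l _ => ?_
  rw [inner_smul_left, conj_trivial, real_inner_comm (L (cubicFrame l)) y]

/-- **`√6·m` is a lattice vector of the frame**: for a menu normal `m` of `G` there is `y ∈ Λ₀` with `G y = √6 • m`
(`m` has `G`-frame coordinates `k_l/√3`, and `√2·c_l` are sums/differences of two slots). -/
theorem exists_lattice_eq_sqrt6_menu (G : EuclideanSpace ℝ (Fin 3) ≃ₗᵢ[ℝ] EuclideanSpace ℝ (Fin 3))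
    {m : EuclideanSpace ℝ (Fin 3)}
    (hmenu : ∀ w ∈ fccSlots, ⟪G w, m⟫_ℝ = 0 ∨ ⟪G w, m⟫_ℝ = Real.sqrt (2 / 3) ∨ ⟪G w, m⟫_ℝ = -Real.sqrt (2 / 3)) :
    ∃ y ∈ fccStacking 1 (Real.sqrt (2 / 3)), G y = Real.sqrt 6 • m := by
  choose k hk using frame_inner_menu G hmenu
  obtain ⟨e0, e1, e2⟩ := cubicFrame_eq_slots
  have hs2 : Real.sqrt 2 ≠ 0 := by positivity
  have h62 : Real.sqrt 6 * Real.sqrt (2 / 3) = 2 := by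
    rw [← Real.sqrt_mul (by norm_num : (0:ℝ) ≤ 6)]; norm_num
  have hs22 : Real.sqrt 2 * Real.sqrt 2 = 2 := Real.mul_self_sqrt (by norm_num)
  -- the coefficient of `√6 m` along `G c_l` is `√2 k_l`
  have hcoef : ∀ l, ⟪Real.sqrt 6 • m, G (cubicFrame l)⟫_ℝ = Real.sqrt 2 * k l := by
    intro l
    rw [inner_smul_left, conj_trivial, real_inner_comm]
    have := hk l
    linear_combination (Real.sqrt 6 * Real.sqrt 2 / 2) * this + (Real.sqrt 2 * (k l : ℝ) / 2) * h62 -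
      (Real.sqrt 6 * ⟪G (cubicFrame l), m⟫_ℝ / 2) * hs22
  refine ⟨(k 0 : ℝ) • (slotSite 0 + slotSite 1) + (k 1 : ℝ) • (slotSite 0 - slotSite 1) +
      (k 2 : ℝ) • (slotSite 4 - slotSite 5), ?_, ?_⟩
  · refine fcc_add_site_mem (fcc_add_site_mem (fcc_zsmul_mem _ ?_) (fcc_zsmul_mem _ ?_)) (fcc_zsmul_mem _ ?_)
    · exact fcc_add_site_mem (mem_fcc_of_mem_fccSlots (slotSite_mem 0)) (mem_fcc_of_mem_fccSlots (slotSite_mem 1))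
    · exact fcc_sub_site_mem (mem_fcc_of_mem_fccSlots (slotSite_mem 0)) (mem_fcc_of_mem_fccSlots (slotSite_mem 1))
    · exact fcc_sub_site_mem (mem_fcc_of_mem_fccSlots (slotSite_mem 4)) (mem_fcc_of_mem_fccSlots (slotSite_mem 5))
  · have hc0 : slotSite 0 + slotSite 1 = Real.sqrt 2 • cubicFrame 0 := by
      rw [e0, smul_smul]; field_simp; rw [one_smul]
    have hc1 : slotSite 0 - slotSite 1 = Real.sqrt 2 • cubicFrame 1 := by
      rw [e1, smul_smul]; field_simp; rw [one_smul]
    have hc2 : slotSite 4 - slotSite 5 = Real.sqrt 2 • cubicFrame 2 := by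
      rw [e2, smul_smul]; field_simp; rw [one_smul]
    rw [hc0, hc1, hc2, eq_sum_cubicFrame G (Real.sqrt 6 • m)]
    simp only [Fin.sum_univ_three, hcoef, map_add, map_smul, smul_smul]
    ring_nf

/-! ### The triadic module of a frame: closure properties -/

/-- Lattice vectors of the frame are triadic (`j = 0`). -/
theorem triadicVec_of_mem (A : EuclideanSpace ℝ (Fin 3) ≃ₗᵢ[ℝ] EuclideanSpace ℝ (Fin 3)) {x : EuclideanSpace ℝ (Fin 3)}
    (hx : x ∈ fccStacking 1 (Real.sqrt (2 / 3))) :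
    ∃ j : ℕ, ((3 : ℝ) ^ j) • A.symm (A x) ∈ fccStacking 1 (Real.sqrt (2 / 3)) :=
  ⟨0, by rw [pow_zero, one_smul, LinearIsometryEquiv.symm_apply_apply]; exact hx⟩

/-- Triadic vectors are closed under addition. -/
theorem triadicVec_add {A : EuclideanSpace ℝ (Fin 3) ≃ₗᵢ[ℝ] EuclideanSpace ℝ (Fin 3)} {v w : EuclideanSpace ℝ (Fin 3)}
    (hv : ∃ j : ℕ, ((3 : ℝ) ^ j) • A.symm v ∈ fccStacking 1 (Real.sqrt (2 / 3)))
    (hw : ∃ j : ℕ, ((3 : ℝ) ^ j) • A.symm w ∈ fccStacking 1 (Real.sqrt (2 / 3))) :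
    ∃ j : ℕ, ((3 : ℝ) ^ j) • A.symm (v + w) ∈ fccStacking 1 (Real.sqrt (2 / 3)) := by
  obtain ⟨i, hv⟩ := hv
  obtain ⟨j, hw⟩ := hw
  refine ⟨i + j, ?_⟩
  have e : ((3 : ℝ) ^ (i + j)) • A.symm (v + w) =
      ((3 : ℝ) ^ j) • (((3 : ℝ) ^ i) • A.symm v) + ((3 : ℝ) ^ i) • (((3 : ℝ) ^ j) • A.symm w) := by
    rw [map_add, smul_add, smul_smul, smul_smul, pow_add]; ring_nf
  rw [e]
  exact fcc_add_site_mem (pow_three_smul_mem_fcc j hv) (pow_three_smul_mem_fcc i hw)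

/-- Triadic vectors are closed under integer multiples. -/
theorem triadicVec_zsmul {A : EuclideanSpace ℝ (Fin 3) ≃ₗᵢ[ℝ] EuclideanSpace ℝ (Fin 3)} {v : EuclideanSpace ℝ (Fin 3)}
    (a : ℤ) (hv : ∃ j : ℕ, ((3 : ℝ) ^ j) • A.symm v ∈ fccStacking 1 (Real.sqrt (2 / 3))) :
    ∃ j : ℕ, ((3 : ℝ) ^ j) • A.symm ((a : ℝ) • v) ∈ fccStacking 1 (Real.sqrt (2 / 3)) := by
  obtain ⟨j, hv⟩ := hv
  refine ⟨j, ?_⟩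
  rw [map_smul, smul_comm]
  exact fcc_zsmul_mem a hv

/-- Triadic vectors are closed under negation. -/
theorem triadicVec_neg {A : EuclideanSpace ℝ (Fin 3) ≃ₗᵢ[ℝ] EuclideanSpace ℝ (Fin 3)} {v : EuclideanSpace ℝ (Fin 3)}
    (hv : ∃ j : ℕ, ((3 : ℝ) ^ j) • A.symm v ∈ fccStacking 1 (Real.sqrt (2 / 3))) :
    ∃ j : ℕ, ((3 : ℝ) ^ j) • A.symm (-v) ∈ fccStacking 1 (Real.sqrt (2 / 3)) := by
  have h := triadicVec_zsmul (-1) hv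
  simpa using h

/-- Triadic vectors are closed under subtraction. -/
theorem triadicVec_sub {A : EuclideanSpace ℝ (Fin 3) ≃ₗᵢ[ℝ] EuclideanSpace ℝ (Fin 3)} {v w : EuclideanSpace ℝ (Fin 3)}
    (hv : ∃ j : ℕ, ((3 : ℝ) ^ j) • A.symm v ∈ fccStacking 1 (Real.sqrt (2 / 3)))
    (hw : ∃ j : ℕ, ((3 : ℝ) ^ j) • A.symm w ∈ fccStacking 1 (Real.sqrt (2 / 3))) :
    ∃ j : ℕ, ((3 : ℝ) ^ j) • A.symm (v - w) ∈ fccStacking 1 (Real.sqrt (2 / 3)) := by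
  rw [sub_eq_add_neg]
  exact triadicVec_add hv (triadicVec_neg hw)

/-- Triadic vectors are closed under division by three. -/
theorem triadicVec_third {A : EuclideanSpace ℝ (Fin 3) ≃ₗᵢ[ℝ] EuclideanSpace ℝ (Fin 3)} {v : EuclideanSpace ℝ (Fin 3)}
    (hv : ∃ j : ℕ, ((3 : ℝ) ^ j) • A.symm v ∈ fccStacking 1 (Real.sqrt (2 / 3))) :
    ∃ j : ℕ, ((3 : ℝ) ^ j) • A.symm ((3 : ℝ)⁻¹ • v) ∈ fccStacking 1 (Real.sqrt (2 / 3)) := by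
  obtain ⟨j, hj⟩ := hv
  refine ⟨j + 1, ?_⟩
  rw [map_smul, smul_smul, pow_succ, mul_assoc, mul_inv_cancel₀ (by norm_num : (3 : ℝ) ≠ 0), mul_one]
  exact hj

/-- Triadic vectors are closed under the scalars `a/3`, `a ∈ ℤ`. -/
theorem triadicVec_zsmul_div_three {A : EuclideanSpace ℝ (Fin 3) ≃ₗᵢ[ℝ] EuclideanSpace ℝ (Fin 3)}
    {v : EuclideanSpace ℝ (Fin 3)} (a : ℤ)
    (hv : ∃ j : ℕ, ((3 : ℝ) ^ j) • A.symm v ∈ fccStacking 1 (Real.sqrt (2 / 3))) :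
    ∃ j : ℕ, ((3 : ℝ) ^ j) • A.symm (((a : ℝ) / 3) • v) ∈ fccStacking 1 (Real.sqrt (2 / 3)) := by
  have e : ((a : ℝ) / 3) • v = (a : ℝ) • ((3 : ℝ)⁻¹ • v) := by rw [smul_smul, div_eq_mul_inv]
  rw [e]
  exact triadicVec_zsmul a (triadicVec_third hv)

/-! ### Frames mapping `Λ₀` into the triadic module -/

/-- A frame maps its own lattice into its triadic module. -/
theorem triadicLattice_self (A : EuclideanSpace ℝ (Fin 3) ≃ₗᵢ[ℝ] EuclideanSpace ℝ (Fin 3)) :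
    ∀ x ∈ fccStacking 1 (Real.sqrt (2 / 3)),
      ∃ j : ℕ, ((3 : ℝ) ^ j) • A.symm (A x) ∈ fccStacking 1 (Real.sqrt (2 / 3)) :=
  fun _ hx => triadicVec_of_mem A hx

/-- A frame with the SAME linear lattice maps `Λ₀` into the triadic module (translation pairs). -/
theorem triadicLattice_of_image_eq {A G : EuclideanSpace ℝ (Fin 3) ≃ₗᵢ[ℝ] EuclideanSpace ℝ (Fin 3)}
    (h : G '' fccStacking 1 (Real.sqrt (2 / 3)) = A '' fccStacking 1 (Real.sqrt (2 / 3))) :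
    ∀ x ∈ fccStacking 1 (Real.sqrt (2 / 3)),
      ∃ j : ℕ, ((3 : ℝ) ^ j) • A.symm (G x) ∈ fccStacking 1 (Real.sqrt (2 / 3)) := by
  intro x hx
  have : G x ∈ A '' fccStacking 1 (Real.sqrt (2 / 3)) := h ▸ ⟨x, hx, rfl⟩
  obtain ⟨y, hy, hyx⟩ := this
  rw [← hyx]
  exact triadicVec_of_mem A hy

/-- **A `{111}` mirror divides by at most three.**  If `G` maps `Λ₀` into `A·Λ₀[1/3]` and `m` is a unit menu normal of
`G`, so does the twin frame `R_m ∘ G`: `R_m (G x) = G x − (2a/3)·(√6 m)` with `⟪G x, m⟫ = a√(2/3)`, `√6 m ∈ G·Λ₀`. -/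
theorem triadicLattice_twin {A G : EuclideanSpace ℝ (Fin 3) ≃ₗᵢ[ℝ] EuclideanSpace ℝ (Fin 3)}
    (hG : ∀ x ∈ fccStacking 1 (Real.sqrt (2 / 3)),
      ∃ j : ℕ, ((3 : ℝ) ^ j) • A.symm (G x) ∈ fccStacking 1 (Real.sqrt (2 / 3)))
    {m : EuclideanSpace ℝ (Fin 3)} (hm : ‖m‖ = 1)
    (hmenu : ∀ w ∈ fccSlots, ⟪G w, m⟫_ℝ = 0 ∨ ⟪G w, m⟫_ℝ = Real.sqrt (2 / 3) ∨ ⟪G w, m⟫_ℝ = -Real.sqrt (2 / 3)) :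
    ∀ x ∈ fccStacking 1 (Real.sqrt (2 / 3)),
      ∃ j : ℕ, ((3 : ℝ) ^ j) • A.symm (twinFrame G m x) ∈ fccStacking 1 (Real.sqrt (2 / 3)) := by
  intro x hx
  rw [twinFrame_apply G hm]
  obtain ⟨a, ha⟩ := inner_lattice_menu G hmenu hx
  obtain ⟨y, hy, hGy⟩ := exists_lattice_eq_sqrt6_menu G hmenu
  have h62 : Real.sqrt (2 / 3) = Real.sqrt 6 / 3 := by
    rw [show (2 / 3 : ℝ) = 6 / 9 by norm_num, Real.sqrt_div' _ (by norm_num : (0:ℝ) ≤ 9),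
      show (9 : ℝ) = 3 ^ 2 by norm_num, Real.sqrt_sq (by norm_num : (0:ℝ) ≤ 3)]
  have e : (2 * ⟪G x, m⟫_ℝ) • m = (((2 * a : ℤ) : ℝ) / 3) • G y := by
    rw [hGy, smul_smul, ha, h62]
    push_cast
    ring_nf
  rw [e]
  exact triadicVec_sub (hG x hx) (triadicVec_zsmul_div_three (2 * a) (hG y hy))

/-- A frame whose linear lattice is the MIRROR TWIN of `A`'s across a menu normal of `A` maps `Λ₀` into `A·Λ₀[1/3]`. -/
theorem triadicLattice_of_image_eq_twin {A G : EuclideanSpace ℝ (Fin 3) ≃ₗᵢ[ℝ] EuclideanSpace ℝ (Fin 3)}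
    {m : EuclideanSpace ℝ (Fin 3)} (hm : ‖m‖ = 1)
    (hmenu : ∀ w ∈ fccSlots, ⟪A w, m⟫_ℝ = 0 ∨ ⟪A w, m⟫_ℝ = Real.sqrt (2 / 3) ∨ ⟪A w, m⟫_ℝ = -Real.sqrt (2 / 3))
    (h : G '' fccStacking 1 (Real.sqrt (2 / 3)) = twinFrame A m '' fccStacking 1 (Real.sqrt (2 / 3))) :
    ∀ x ∈ fccStacking 1 (Real.sqrt (2 / 3)),
      ∃ j : ℕ, ((3 : ℝ) ^ j) • A.symm (G x) ∈ fccStacking 1 (Real.sqrt (2 / 3)) := by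
  intro x hx
  have : G x ∈ twinFrame A m '' fccStacking 1 (Real.sqrt (2 / 3)) := h ▸ ⟨x, hx, rfl⟩
  obtain ⟨y, hy, hyx⟩ := this
  rw [← hyx]
  exact triadicLattice_twin (triadicLattice_self A) hm hmenu y hy

/-- **Every co-axial partner maps `Λ₀` into `A₁·Λ₀[1/3]`.**  If `(A₁, t₁)` and `(A₂, t₂)` are co-axial (the crux's data:
both affine lattices inside Barlow stackings of one frame) then the linear lattices are equal or mirror twins across a
menu normal of `A₁` (`eq_or_twin_of_coaxial`), hence `A₂·Λ₀ ⊆ A₁·Λ₀[1/3]`. -/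
theorem triadicLattice_of_coaxial
    (A₁ : EuclideanSpace ℝ (Fin 3) ≃ₗᵢ[ℝ] EuclideanSpace ℝ (Fin 3)) (t₁ : EuclideanSpace ℝ (Fin 3))
    (A₂ : EuclideanSpace ℝ (Fin 3) ≃ₗᵢ[ℝ] EuclideanSpace ℝ (Fin 3)) (t₂ : EuclideanSpace ℝ (Fin 3))
    (hco : ∃ (L : EuclideanSpace ℝ (Fin 3) ≃ₗᵢ[ℝ] EuclideanSpace ℝ (Fin 3))
        (s₁ s₂ : EuclideanSpace ℝ (Fin 3)) (σ σ' : ℤ → ℤ), IsHaggSeq σ ∧ IsHaggSeq σ' ∧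
        (fun p => A₁ p + t₁) '' fccStacking 1 (Real.sqrt (2 / 3)) ⊆
          (fun p => L p + s₁) '' barlowStacking 1 (Real.sqrt (2 / 3)) σ ∧
        (fun p => A₂ p + t₂) '' fccStacking 1 (Real.sqrt (2 / 3)) ⊆
          (fun p => L p + s₂) '' barlowStacking 1 (Real.sqrt (2 / 3)) σ') :
    ∀ x ∈ fccStacking 1 (Real.sqrt (2 / 3)),
      ∃ j : ℕ, ((3 : ℝ) ^ j) • A₁.symm (A₂ x) ∈ fccStacking 1 (Real.sqrt (2 / 3)) := by
  have hco0 := coaxial_translate A₁ A₂ t₁ t₂ 0 0 hco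
  have h1 : (fun p : EuclideanSpace ℝ (Fin 3) => A₁ p + 0) = (A₁ : EuclideanSpace ℝ (Fin 3) → EuclideanSpace ℝ (Fin 3)) :=
    funext fun p => add_zero _
  have h2 : (fun p : EuclideanSpace ℝ (Fin 3) => A₂ p + 0) = (A₂ : EuclideanSpace ℝ (Fin 3) → EuclideanSpace ℝ (Fin 3)) :=
    funext fun p => add_zero _
  rw [h1, h2] at hco0
  rcases eq_or_twin_of_coaxial A₁ A₂ hco0 with heq | ⟨m, hm, hmenu, htwin⟩
  · exact triadicLattice_of_image_eq heq.symm
  · exact triadicLattice_of_image_eq_twin hm hmenu htwin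

/-! ### Heights of triadic vectors -/

/-- **Heights of triadic vectors are triadic integers**: for a menu normal `ν` of `A` and a triadic `v`,
`3^j ⟪v, ν⟫ = a·√(2/3)` for some `j : ℕ`, `a : ℤ`. -/
theorem inner_menu_of_triadicVec {A : EuclideanSpace ℝ (Fin 3) ≃ₗᵢ[ℝ] EuclideanSpace ℝ (Fin 3)}
    {ν : EuclideanSpace ℝ (Fin 3)}
    (hmenu : ∀ w ∈ fccSlots, ⟪A w, ν⟫_ℝ = 0 ∨ ⟪A w, ν⟫_ℝ = Real.sqrt (2 / 3) ∨ ⟪A w, ν⟫_ℝ = -Real.sqrt (2 / 3))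
    {v : EuclideanSpace ℝ (Fin 3)} (hv : ∃ j : ℕ, ((3 : ℝ) ^ j) • A.symm v ∈ fccStacking 1 (Real.sqrt (2 / 3))) :
    ∃ j : ℕ, ∃ a : ℤ, (3 : ℝ) ^ j * ⟪v, ν⟫_ℝ = a * Real.sqrt (2 / 3) := by
  obtain ⟨j, hj⟩ := hv
  obtain ⟨a, ha⟩ := inner_lattice_menu A hmenu hj
  refine ⟨j, a, ?_⟩
  rw [← ha, map_smul, LinearIsometryEquiv.apply_symm_apply, inner_smul_left, conj_trivial]

/-- **Non-triadic heights.**  If `⟪v, ν⟫ = r·√(2/3)` for a menu normal `ν` of `A` with `3^j r ∉ ℤ` for every `j`, then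
`v ∉ A·Λ₀[1/3]` (e.g. `r = a + ½`; every irrational `r`). -/
theorem not_triadicVec_of_inner {A : EuclideanSpace ℝ (Fin 3) ≃ₗᵢ[ℝ] EuclideanSpace ℝ (Fin 3)}
    {ν : EuclideanSpace ℝ (Fin 3)}
    (hmenu : ∀ w ∈ fccSlots, ⟪A w, ν⟫_ℝ = 0 ∨ ⟪A w, ν⟫_ℝ = Real.sqrt (2 / 3) ∨ ⟪A w, ν⟫_ℝ = -Real.sqrt (2 / 3))
    {v : EuclideanSpace ℝ (Fin 3)} {r : ℝ} (hr : ⟪v, ν⟫_ℝ = r * Real.sqrt (2 / 3))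
    (hnot : ∀ j : ℕ, ∀ a : ℤ, (3 : ℝ) ^ j * r ≠ a) :
    ¬ ∃ j : ℕ, ((3 : ℝ) ^ j) • A.symm v ∈ fccStacking 1 (Real.sqrt (2 / 3)) := by
  intro hv
  obtain ⟨j, a, h⟩ := inner_menu_of_triadicVec hmenu hv
  have hs : Real.sqrt (2 / 3) ≠ 0 := by positivity
  rw [hr, ← mul_assoc] at h
  exact hnot j a (mul_right_cancel₀ hs h)

/-- The half-integer case: `3^j (a + ½)` is never an integer. -/
theorem pow_three_mul_add_half_ne_int (a : ℤ) (j : ℕ) (b : ℤ) : (3 : ℝ) ^ j * (a + 1 / 2) ≠ b := by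
  intro h
  have h2 : (3 : ℤ) ^ j * (2 * a + 1) = 2 * b := by
    have : ((3 : ℤ) ^ j * (2 * a + 1) : ℝ) = (2 * b : ℝ) := by push_cast; linear_combination 2 * h
    exact_mod_cast this
  have hodd : Odd ((3 : ℤ) ^ j * (2 * a + 1)) := (Odd.pow (by decide : Odd (3 : ℤ))).mul ⟨a, by ring⟩
  rw [h2] at hodd
  exact (Int.not_odd_iff_even.2 ⟨b, by ring⟩) hodd

/-- **Half-integer offsets are not triadic**: `⟪v, ν⟫ = (a + ½)·√(2/3)` for a menu normal `ν` of `A` ⇒ `v ∉ A·Λ₀[1/3]`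
(the offset class of lit's `T*`: grain 2's basal planes half-way between grain 1's). -/
theorem not_triadicVec_of_inner_half {A : EuclideanSpace ℝ (Fin 3) ≃ₗᵢ[ℝ] EuclideanSpace ℝ (Fin 3)}
    {ν : EuclideanSpace ℝ (Fin 3)}
    (hmenu : ∀ w ∈ fccSlots, ⟪A w, ν⟫_ℝ = 0 ∨ ⟪A w, ν⟫_ℝ = Real.sqrt (2 / 3) ∨ ⟪A w, ν⟫_ℝ = -Real.sqrt (2 / 3))
    {v : EuclideanSpace ℝ (Fin 3)} (a : ℤ) (hr : ⟪v, ν⟫_ℝ = (a + 1 / 2) * Real.sqrt (2 / 3)) :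
    ¬ ∃ j : ℕ, ((3 : ℝ) ^ j) • A.symm v ∈ fccStacking 1 (Real.sqrt (2 / 3)) :=
  not_triadicVec_of_inner hmenu hr fun j b => pow_three_mul_add_half_ne_int a j b

end Summit.Ventures.Crystal3D.Theorems

end
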